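import Mathlib
import HarnessLib
import Summits.HubbardSuperconductivity.HubbardSuperconductivity.Theorems.ChiralWindowCwKLChiralWindowFrameHS
import Summits.HubbardSuperconductivity.HubbardSuperconductivity.Theorems.ChiralWindowCwKLChiralWindowKernelHS
import Summits.HubbardSuperconductivity.HubbardSuperconductivity.Theorems.ChiralWindowCwKLChiralWindowMeanZero
import Summits.HubbardSuperconductivity.HubbardSuperconductivity.Theorems.ChiralWindowCwKLChiralWindowD4Invariant
import Literature.Analysis.OperatorTheory.CompactSelfAdjointBottom

/-!
# `stub_klBottomStates`: bottom states of a symmetry channel of the Kohn–Luttinger vertex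

For the nearest-neighbour band `ε₀ = squareDispersion 1 0`, `μ ∈ (-4, 0)` (so that the Fermi-curve measure
`σ_μ = fermiCurveMeasure ε₀ μ` is finite and `D₄`-invariant and the Lindhard kernel `χ₀(k + k')` is in
`L²(σ_μ ⊗ σ_μ)`), a channel `χ ≠ A1g`, the integral operator `A` of `χ₀(k + k')` on `H = L²(σ_μ)` (given
abstractly: a.e. action, matrix elements, self-adjoint, compact) and a projection `P` commuting with `A`
whose fixed vectors are exactly the classes of square-integrable channel-`χ` functions:

* DICTIONARY. Channel states `ψ` (`ψ ∈ L²`, `∫ ψ² = 1`, `InChannel χ ψ`) correspond to unit vectors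
  `φ = [ψ]` of `H` fixed by `P`, and `pairingForm ε₀ μ 1 ψ = ⟪φ, A φ⟫`: by the splitting
  `⟨ψ, Γ₁ ψ⟩ = (∫ ψ)² + ∫ ψ (∫ χ₀(k + k') ψ)` (`klhs_frame_pairingForm_split`) and the vanishing of the mean of
  a non-`A1g` channel state (`stub_klMeanZero`).  Hence `channelInf ε₀ μ 1 χ` is the greatest lower bound
  of the Rayleigh quotient of `A` on the fixed space of `P`.
* BOTTOM. By the abstract statement for compact self-adjoint operators
  (`Literature.Analysis.OperatorTheory.exists_rayleigh_eq_of_isGLB_of_neg_of_commute_real`: Hilbert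
  eigenbasis, eigenvalues accumulate only at `0`), a negative bottom is attained and every minimiser is an
  eigenvector, `A φ = channelInf · φ`; unfolding the a.e. action of `A` gives the eigen-equation
  `∫ χ₀(k + k') ψ(k') dσ_μ(k') = channelInf · ψ(k)` for a.e. `k`.
-/

noncomputable section

set_option linter.dupNamespace false

namespace Summit.HubbardSuperconductivity.HubbardSuperconductivity.Theorems

open MeasureTheory Literature.MathematicalPhysics.QuantumLattice
open scoped InnerProductSpace

/-- `‖φ‖² = ∫ φ²` for a real `L²` class. [folklore] -/
theorem kl_bs_norm_sq_eq_integral {X : Type*} [MeasurableSpace X] {ν : Measure X} (φ : Lp ℝ 2 ν) :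
    ‖φ‖ ^ 2 = ∫ x, φ x ^ 2 ∂ν := by
  rw [← real_inner_self_eq_norm_sq, MeasureTheory.L2.inner_def]
  refine integral_congr_ae (Filter.Eventually.of_forall fun x => ?_)
  simp only [RCLike.inner_apply, conj_trivial, sq]

/-- `‖φ‖² = ∫ ψ²` for a real `L²` class `φ` represented by `ψ`. [folklore] -/
theorem kl_bs_norm_sq_eq_integral_of_ae_eq {X : Type*} [MeasurableSpace X] {ν : Measure X} {φ : Lp ℝ 2 ν}
    {ψ : X → ℝ} (h : (φ : X → ℝ) =ᵐ[ν] ψ) : ‖φ‖ ^ 2 = ∫ x, ψ x ^ 2 ∂ν := by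
  rw [kl_bs_norm_sq_eq_integral]
  exact integral_congr_ae (by filter_upwards [h] with x hx; rw [hx])

/-- A convolution-type kernel integral `∫ K(k + k') φ(k') dν(k')` only depends on the class of `φ`. [folklore] -/
theorem kl_bs_kernelIntegral_congr {ν : Measure Momentum} (K : Momentum → ℝ) {φ ψ : Momentum → ℝ}
    (h : φ =ᵐ[ν] ψ) (k : Momentum) : ∫ k', K (k + k') * φ k' ∂ν = ∫ k', K (k + k') * ψ k' ∂ν :=
  integral_congr_ae (by filter_upwards [h] with k' hk'; rw [hk'])

/-- **Matrix elements on representatives.** If `⟪ψ, A φ⟫ = ∫ ψ (∫ K(k + k') φ)` on `L²(ν)`, then for a class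
`φ` represented by the function `ψ`, `⟪φ, A φ⟫ = ∫ ψ(k) (∫ K(k + k') ψ(k') dν) dν`. [folklore] -/
theorem kl_bs_inner_eq_of_ae_eq {ν : Measure Momentum} (K : Momentum → ℝ) (A : Lp ℝ 2 ν →L[ℝ] Lp ℝ 2 ν)
    (hAinner : ∀ φ ψ : Lp ℝ 2 ν, inner ℝ ψ (A φ) = ∫ k, ψ k * ∫ k', K (k + k') * φ k' ∂ν ∂ν)
    {φ : Lp ℝ 2 ν} {ψ : Momentum → ℝ} (h : (φ : Momentum → ℝ) =ᵐ[ν] ψ) :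
    ⟪φ, A φ⟫_ℝ = ∫ k, ψ k * ∫ k', K (k + k') * ψ k' ∂ν ∂ν := by
  rw [hAinner]
  refine integral_congr_ae ?_
  filter_upwards [h] with k hk
  rw [hk, kl_bs_kernelIntegral_congr K h k]

variable {μ : ℝ} {χ : D4Irrep}
  {A P : Lp ℝ 2 (fermiCurveMeasure (squareDispersion 1 0) μ) →L[ℝ] Lp ℝ 2 (fermiCurveMeasure (squareDispersion 1 0) μ)}

/-- **The pairing form of a non-`A1g` channel state at `U = 1` is the Lindhard form**:
`pairingForm ε₀ μ 1 ψ = ∫ ψ(k) (∫ χ₀(k + k') ψ(k') dσ_μ) dσ_μ` for `μ ∈ (-4, 0)`, `χ ≠ A1g` and every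
channel-`χ` state `ψ` (splitting of the form and vanishing mean). [folklore] -/
theorem kl_bs_pairingForm_eq (hμ : μ ∈ Set.Ioo (-4 : ℝ) 0) (hχ : χ ≠ D4Irrep.A1g)
    {ψ : Momentum → ℝ} (hψ : IsChannelState (squareDispersion 1 0) μ χ ψ) :
    pairingForm (squareDispersion 1 0) μ 1 ψ =
      ∫ k, ψ k * ∫ k', lindhardFunction (squareDispersion 1 0) μ (k + k') * ψ k'
        ∂fermiCurveMeasure (squareDispersion 1 0) μ ∂fermiCurveMeasure (squareDispersion 1 0) μ := by
  haveI : IsFiniteMeasure (fermiCurveMeasure (squareDispersion 1 0) μ) :=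
    stub_klFiniteMeasure stub_klGradient stub_klHausdorffFinite μ hμ
  have hmean := (stub_klMeanZero (squareDispersion 1 0) μ ‹_›
    (fun g => stub_klD4Invariant stub_klGradient μ hμ g) χ ψ hχ hψ).2
  rw [klhs_frame_pairingForm_split 1 (stub_klKernelHS μ hμ) hψ.1, hmean]
  ring

/-- **Dictionary, channel state ↦ fixed unit vector.** For a channel-`χ` state `ψ` the class `[ψ] ∈ L²(σ_μ)`
is fixed by `P`, has norm `1`, and `⟪[ψ], A [ψ]⟫ = pairingForm ε₀ μ 1 ψ`. [folklore] -/
theorem kl_bs_toLp (hμ : μ ∈ Set.Ioo (-4 : ℝ) 0) (hχ : χ ≠ D4Irrep.A1g)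
    (hAinner : ∀ φ ψ : Lp ℝ 2 (fermiCurveMeasure (squareDispersion 1 0) μ),
      inner ℝ ψ (A φ) = ∫ k, ψ k * ∫ k', lindhardFunction (squareDispersion 1 0) μ (k + k') * φ k'
        ∂fermiCurveMeasure (squareDispersion 1 0) μ ∂fermiCurveMeasure (squareDispersion 1 0) μ)
    (hPfix : ∀ (ψ : Momentum → ℝ) (hψ : MemLp ψ 2 (fermiCurveMeasure (squareDispersion 1 0) μ)),
      InChannel χ ψ → P (hψ.toLp ψ) = hψ.toLp ψ)
    {ψ : Momentum → ℝ} (hψ : IsChannelState (squareDispersion 1 0) μ χ ψ) :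
    P (hψ.1.toLp ψ) = hψ.1.toLp ψ ∧ ‖hψ.1.toLp ψ‖ = 1 ∧
      ⟪hψ.1.toLp ψ, A (hψ.1.toLp ψ)⟫_ℝ = pairingForm (squareDispersion 1 0) μ 1 ψ := by
  have hae : (hψ.1.toLp ψ : Momentum → ℝ) =ᵐ[fermiCurveMeasure (squareDispersion 1 0) μ] ψ := hψ.1.coeFn_toLp
  refine ⟨hPfix ψ hψ.1 hψ.2.2, ?_, ?_⟩
  · have h2 : ‖hψ.1.toLp ψ‖ ^ 2 = 1 := by rw [kl_bs_norm_sq_eq_integral_of_ae_eq hae, hψ.2.1]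
    exact (pow_eq_one_iff_of_nonneg (norm_nonneg _) two_ne_zero).1 h2
  · rw [kl_bs_inner_eq_of_ae_eq _ A hAinner hae, kl_bs_pairingForm_eq hμ hχ hψ]

/-- **Dictionary, fixed unit vector ↦ channel state.** A unit vector `φ ∈ L²(σ_μ)` fixed by `P` is the
class of a channel-`χ` state `ψ` with `pairingForm ε₀ μ 1 ψ = ⟪φ, A φ⟫`. [folklore] -/
theorem kl_bs_repr (hμ : μ ∈ Set.Ioo (-4 : ℝ) 0) (hχ : χ ≠ D4Irrep.A1g)
    (hAinner : ∀ φ ψ : Lp ℝ 2 (fermiCurveMeasure (squareDispersion 1 0) μ),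
      inner ℝ ψ (A φ) = ∫ k, ψ k * ∫ k', lindhardFunction (squareDispersion 1 0) μ (k + k') * φ k'
        ∂fermiCurveMeasure (squareDispersion 1 0) μ ∂fermiCurveMeasure (squareDispersion 1 0) μ)
    (hPrepr : ∀ φ : Lp ℝ 2 (fermiCurveMeasure (squareDispersion 1 0) μ), P φ = φ →
      ∃ ψ : Momentum → ℝ, InChannel χ ψ ∧ MemLp ψ 2 (fermiCurveMeasure (squareDispersion 1 0) μ) ∧
        (φ : Momentum → ℝ) =ᵐ[fermiCurveMeasure (squareDispersion 1 0) μ] ψ)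
    {φ : Lp ℝ 2 (fermiCurveMeasure (squareDispersion 1 0) μ)} (hPφ : P φ = φ) (hφ : ‖φ‖ = 1) :
    ∃ ψ : Momentum → ℝ, IsChannelState (squareDispersion 1 0) μ χ ψ ∧
      (φ : Momentum → ℝ) =ᵐ[fermiCurveMeasure (squareDispersion 1 0) μ] ψ ∧
      pairingForm (squareDispersion 1 0) μ 1 ψ = ⟪φ, A φ⟫_ℝ := by
  obtain ⟨ψ, hch, hmem, hae⟩ := hPrepr φ hPφ
  have hstate : IsChannelState (squareDispersion 1 0) μ χ ψ :=
    ⟨hmem, by rw [← kl_bs_norm_sq_eq_integral_of_ae_eq hae, hφ, one_pow], hch⟩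
  exact ⟨ψ, hstate, hae, by rw [kl_bs_pairingForm_eq hμ hχ hstate, kl_bs_inner_eq_of_ae_eq _ A hAinner hae]⟩

/-- **The values of the pairing form on channel states are the Rayleigh quotients of `A` on the fixed
space of `P`.** [folklore] -/
theorem kl_bs_range_eq (hμ : μ ∈ Set.Ioo (-4 : ℝ) 0) (hχ : χ ≠ D4Irrep.A1g)
    (hAinner : ∀ φ ψ : Lp ℝ 2 (fermiCurveMeasure (squareDispersion 1 0) μ),
      inner ℝ ψ (A φ) = ∫ k, ψ k * ∫ k', lindhardFunction (squareDispersion 1 0) μ (k + k') * φ k'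
        ∂fermiCurveMeasure (squareDispersion 1 0) μ ∂fermiCurveMeasure (squareDispersion 1 0) μ)
    (hPfix : ∀ (ψ : Momentum → ℝ) (hψ : MemLp ψ 2 (fermiCurveMeasure (squareDispersion 1 0) μ)),
      InChannel χ ψ → P (hψ.toLp ψ) = hψ.toLp ψ)
    (hPrepr : ∀ φ : Lp ℝ 2 (fermiCurveMeasure (squareDispersion 1 0) μ), P φ = φ →
      ∃ ψ : Momentum → ℝ, InChannel χ ψ ∧ MemLp ψ 2 (fermiCurveMeasure (squareDispersion 1 0) μ) ∧
        (φ : Momentum → ℝ) =ᵐ[fermiCurveMeasure (squareDispersion 1 0) μ] ψ) :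
    pairingForm (squareDispersion 1 0) μ 1 '' {ψ | IsChannelState (squareDispersion 1 0) μ χ ψ} =
      {r : ℝ | ∃ φ : Lp ℝ 2 (fermiCurveMeasure (squareDispersion 1 0) μ), P φ = φ ∧ ‖φ‖ = 1 ∧ ⟪φ, A φ⟫_ℝ = r} := by
  ext r
  simp only [Set.mem_image, Set.mem_setOf_eq]
  constructor
  · rintro ⟨ψ, hψ, rfl⟩
    obtain ⟨h1, h2, h3⟩ := kl_bs_toLp hμ hχ hAinner hPfix hψ
    exact ⟨_, h1, h2, h3⟩
  · rintro ⟨φ, hPφ, hφ, rfl⟩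
    obtain ⟨ψ, hψ, -, hval⟩ := kl_bs_repr hμ hχ hAinner hPrepr hPφ hφ
    exact ⟨ψ, hψ, hval⟩

/-- **Bottom states of a channel (existence and eigen-equation), abstract form.** Let `μ ∈ (-4,0)`, `χ ≠ A1g`,
`A` the (compact, self-adjoint) integral operator of `χ₀(k+k')` on `L²(σ_μ)` and `P` an orthogonal projection
commuting with `A` whose range is the classes of channel-`χ` functions.  If the channel bottom
`channelInf ε₀ μ 1 χ` is negative, it is attained by a channel state, and every channel state attaining it solves
`∫ χ₀(k+k') ψ(k') dσ(k') = channelInf · ψ(k)` a.e. (for `χ ≠ A1g` channel states are mean-zero, so the pairing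
form at `U = 1` is `⟨ψ, Aψ⟩`; spectral theorem for the compact self-adjoint compression of `A` to `ran P`,
Reed–Simon I, Thm. VI.16). [folklore] -/
theorem stub_klBottomStates : ∀ μ ∈ Set.Ioo (-4 : ℝ) 0, ∀ (χ : D4Irrep)
    (A P : Lp ℝ 2 (fermiCurveMeasure (squareDispersion 1 0) μ) →L[ℝ] Lp ℝ 2 (fermiCurveMeasure (squareDispersion 1 0) μ)),
    χ ≠ D4Irrep.A1g →
    (∀ φ : Lp ℝ 2 (fermiCurveMeasure (squareDispersion 1 0) μ),
      (A φ : Momentum → ℝ) =ᵐ[fermiCurveMeasure (squareDispersion 1 0) μ]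
        fun k => ∫ k', lindhardFunction (squareDispersion 1 0) μ (k + k') * φ k'
          ∂fermiCurveMeasure (squareDispersion 1 0) μ) →
    (∀ φ ψ : Lp ℝ 2 (fermiCurveMeasure (squareDispersion 1 0) μ),
      inner ℝ ψ (A φ) =
        ∫ k, ψ k * ∫ k', lindhardFunction (squareDispersion 1 0) μ (k + k') * φ k'
          ∂fermiCurveMeasure (squareDispersion 1 0) μ ∂fermiCurveMeasure (squareDispersion 1 0) μ) →
    IsSelfAdjoint A → IsCompactOperator A →
    P * P = P → IsSelfAdjoint P → A * P = P * A →
    (∀ (ψ : Momentum → ℝ) (hψ : MemLp ψ 2 (fermiCurveMeasure (squareDispersion 1 0) μ)),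
      InChannel χ ψ → P (hψ.toLp ψ) = hψ.toLp ψ) →
    (∀ φ : Lp ℝ 2 (fermiCurveMeasure (squareDispersion 1 0) μ), P φ = φ →
      ∃ ψ : Momentum → ℝ, InChannel χ ψ ∧ MemLp ψ 2 (fermiCurveMeasure (squareDispersion 1 0) μ) ∧
        (φ : Momentum → ℝ) =ᵐ[fermiCurveMeasure (squareDispersion 1 0) μ] ψ) →
    channelInf (squareDispersion 1 0) μ 1 χ < 0 →
    (∃ ψ : Momentum → ℝ, IsChannelState (squareDispersion 1 0) μ χ ψ ∧
      pairingForm (squareDispersion 1 0) μ 1 ψ = channelInf (squareDispersion 1 0) μ 1 χ) ∧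
    (∀ ψ : Momentum → ℝ, IsChannelState (squareDispersion 1 0) μ χ ψ →
      pairingForm (squareDispersion 1 0) μ 1 ψ = channelInf (squareDispersion 1 0) μ 1 χ →
      ∀ᵐ k ∂fermiCurveMeasure (squareDispersion 1 0) μ,
        ∫ k', lindhardFunction (squareDispersion 1 0) μ (k + k') * ψ k' ∂fermiCurveMeasure (squareDispersion 1 0) μ =
          channelInf (squareDispersion 1 0) μ 1 χ * ψ k) := by
  intro μ hμ χ A P hχ hA hAinner hAsa hAc _hPP _hPsa hAP hPfix hPrepr hneg
  -- the channel bottom is the greatest lower bound of the Rayleigh quotient of `A` on the fixed space of `P`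
  set R := pairingForm (squareDispersion 1 0) μ 1 '' {ψ | IsChannelState (squareDispersion 1 0) μ χ ψ} with hR
  have hinf : channelInf (squareDispersion 1 0) μ 1 χ = sInf R := rfl
  have hne : R.Nonempty := by
    by_contra h
    rw [Set.not_nonempty_iff_eq_empty] at h
    rw [hinf, h, Real.sInf_empty] at hneg
    exact lt_irrefl _ hneg
  have hbdd : BddBelow R := by
    by_contra h
    rw [hinf, Real.sInf_of_not_bddBelow h] at hneg
    exact lt_irrefl _ hneg
  have hglb : IsGLB R (channelInf (squareDispersion 1 0) μ 1 χ) := Real.isGLB_sInf hne hbdd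
  rw [hR, kl_bs_range_eq hμ hχ hAinner hPfix hPrepr] at hglb
  -- the abstract bottom of a compact self-adjoint operator in a symmetry sector
  obtain ⟨⟨φ, hPφ, hφ, hval⟩, heig⟩ :=
    Literature.Analysis.OperatorTheory.exists_rayleigh_eq_of_isGLB_of_neg_of_commute_real hAsa hAc hAP hglb hneg
  refine ⟨?_, fun ψ hψ hmin => ?_⟩
  · obtain ⟨ψ, hψ, -, hval'⟩ := kl_bs_repr hμ hχ hAinner hPrepr hPφ hφ
    exact ⟨ψ, hψ, hval'.trans hval⟩
  · obtain ⟨h1, h2, h3⟩ := kl_bs_toLp hμ hχ hAinner hPfix hψ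
    have hAφ := heig _ h1 h2 (h3.trans hmin)
    have hae := hA (hψ.1.toLp ψ)
    rw [hAφ] at hae
    filter_upwards [hae, Lp.coeFn_smul (channelInf (squareDispersion 1 0) μ 1 χ) (hψ.1.toLp ψ),
      hψ.1.coeFn_toLp] with k hk hsmul hrep
    rw [← kl_bs_kernelIntegral_congr _ hψ.1.coeFn_toLp k, ← hk, hsmul, Pi.smul_apply, smul_eq_mul, hrep]

end Summit.HubbardSuperconductivity.HubbardSuperconductivity.Theorems

end
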